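import Summits.CriticalPhenomena.PercolationContinuityZ3.Theorems.PercNearOneGluingNoHeavyLowerTailSahiOneStepUpperMonoA
import HarnessLib

/-!
# Two-sided lumping — the functional `Ψ`, its monotonicity under hulls and compressions, and the cross-form step lemma

Support file (prover prim-ineq-prove-3 gen 50; `--supports stmt-CriticalPhenomena-4575`; memo
`run/shared/lean/prim/prim-ineq-prove-3/FINDING-G50-TWO-SIDED-LUMPING.md`, §2.1–2.4).  No definitions, no named facts, no sorries, no `native_decide`.

For a block `G`, levels `t ≤ s`, the lower ball `L = {#(G∩ω) < t}`, the upper ball `U = T_s = {s ≤ #(G∩ω)}` and `T_t = {t ≤ #(G∩ω)}`, the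
TWO-SIDED LUMPING FUNCTIONAL of increasing events `A, B` is (always written out in full, no definition)
`Ψ = (1−μT_t)·μT_s·(μ(T_t∩A∩B) − μ(T_s∩A∩B)) + μT_s·(μA − μ(T_t∩A))(μB − μ(T_t∩B)) + (1−μT_t)·μ(T_s∩A)μ(T_s∩B) − (1−μT_t)·μT_s·μA·μB`
`  = μ(L)μ(U)·[Cov(A,B) − μ(L)Cov(A,B|L) − μ(U)Cov(A,B|U)]`.
This file proves: `Ψ` does not increase under the `T_t`-generated hull of `B` (`twoLump_hgen_le`), under the hull of `B` generated below `s`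
(`twoLump_genb_le`), under opposite compressions (`twoLump_compress_le`, uniform density on the pair), and the CROSS-FORM STEP LEMMA
`twoLump_nonneg_of_cross`: the two-sided pivot identity (memo TL1, polynomial form `twoLump_step_real`) makes `Ψ ≥ 0` follow from `Ψ ≥ 0` for the two
section pairs, monotone sections, and the four drift signs (lower: `drift_nonneg_of_dominant` / `drift_nonpos_of_dominated`; upper:
`upperDrift_nonneg_of_dominant` / `upperDrift_nonpos_of_dominated`).
-/

noncomputable section

namespace Summit.CriticalPhenomena.PercolationContinuityZ3.Theorems

namespace SahiOneStep

open MeasureTheory Finset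
open Literature.Probability.Percolation (DeterminedBy determinedBy_iff)
open Literature.Probability.LatticeModels (prodBernoulli prodBernoulli_harris)
open Literature.Probability.Percolation.DecisionTree (ind)
open SahiE3Sections (determinedBy_section_insert determinedBy_section_sdiff)
open scoped Classical

variable {ι : Type*} [Fintype ι]

/-! ## The real-variable step (two-sided pivot identity in polynomial form) -/

omit [Fintype ι] in
/-- **Two-sided cross-form step, real-variable form** (memo TL1 multiplied by `ℓ₁ℓ₀u₁u₀`):
`ℓ₁ℓ₀u₁u₀·Ψ = P·ℓu·ℓ₀u₀·Ψ¹ + (1−P)·ℓu·ℓ₁u₁·Ψ⁰ + P(1−P)·[ℓuℓ₁ℓ₀u₁u₀·Δa·Δb − u·u₁u₀·W_A·W_B − ℓ·ℓ₁ℓ₀·V_A·V_B]`, hence `Ψ ≥ 0` from `Ψ¹, Ψ⁰ ≥ 0`,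
monotone sections, `W_A ≥ 0 ≥ W_B`, `V_A ≥ 0 ≥ V_B`. [this work] -/
theorem twoLump_step_real (P a1 a0 b1 b0 ta1 ta0 tb1 tb0 sa1 sa0 sb1 sb0 tab1 tab0 sab1 sab0 T1 T0 S1 S0
    TT SS AA BB TA TB SA SB TAB SAB : ℝ)
    (hP0 : 0 ≤ P) (hP1 : P ≤ 1) (hT1 : T1 < 1) (hT0 : T0 < 1) (hS1 : 0 < S1) (hS0 : 0 < S0)
    (eTT : TT = P * T1 + (1 - P) * T0) (eSS : SS = P * S1 + (1 - P) * S0)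
    (eAA : AA = P * a1 + (1 - P) * a0) (eBB : BB = P * b1 + (1 - P) * b0)
    (eTA : TA = P * ta1 + (1 - P) * ta0) (eTB : TB = P * tb1 + (1 - P) * tb0)
    (eSA : SA = P * sa1 + (1 - P) * sa0) (eSB : SB = P * sb1 + (1 - P) * sb0)
    (eTAB : TAB = P * tab1 + (1 - P) * tab0) (eSAB : SAB = P * sab1 + (1 - P) * sab0)
    (h1 : 0 ≤ (1 - T1) * S1 * (tab1 - sab1) + S1 * (a1 - ta1) * (b1 - tb1) + (1 - T1) * sa1 * sb1 - (1 - T1) * S1 * a1 * b1)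
    (h0 : 0 ≤ (1 - T0) * S0 * (tab0 - sab0) + S0 * (a0 - ta0) * (b0 - tb0) + (1 - T0) * sa0 * sb0 - (1 - T0) * S0 * a0 * b0)
    (hA : a0 ≤ a1) (hB : b0 ≤ b1)
    (hWA : 0 ≤ (1 - T0) * (a1 - ta1) - (1 - T1) * (a0 - ta0)) (hWB : (1 - T0) * (b1 - tb1) - (1 - T1) * (b0 - tb0) ≤ 0)
    (hVA : S1 * sa0 ≤ S0 * sa1) (hVB : S0 * sb1 ≤ S1 * sb0) :
    0 ≤ (1 - TT) * SS * (TAB - SAB) + SS * (AA - TA) * (BB - TB) + (1 - TT) * SA * SB - (1 - TT) * SS * AA * BB := by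
  have hl1 : 0 < 1 - T1 := sub_pos.2 hT1
  have hl0 : 0 < 1 - T0 := sub_pos.2 hT0
  have hQ : 0 ≤ 1 - P := sub_nonneg.2 hP1
  have hl : 0 ≤ 1 - TT := by rw [eTT]; nlinarith
  have hu : 0 ≤ SS := by rw [eSS]; nlinarith
  -- the identity
  have key : (1 - T1) * (1 - T0) * S1 * S0 *
      ((1 - TT) * SS * (TAB - SAB) + SS * (AA - TA) * (BB - TB) + (1 - TT) * SA * SB - (1 - TT) * SS * AA * BB) =
      P * ((1 - TT) * SS) * ((1 - T0) * S0) *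
          ((1 - T1) * S1 * (tab1 - sab1) + S1 * (a1 - ta1) * (b1 - tb1) + (1 - T1) * sa1 * sb1 - (1 - T1) * S1 * a1 * b1)
        + (1 - P) * ((1 - TT) * SS) * ((1 - T1) * S1) *
          ((1 - T0) * S0 * (tab0 - sab0) + S0 * (a0 - ta0) * (b0 - tb0) + (1 - T0) * sa0 * sb0 - (1 - T0) * S0 * a0 * b0)
        + P * (1 - P) *
          (((1 - TT) * SS) * ((1 - T1) * (1 - T0) * S1 * S0) * ((a1 - a0) * (b1 - b0))
            + SS * (S1 * S0) * (-(((1 - T0) * (a1 - ta1) - (1 - T1) * (a0 - ta0)) * ((1 - T0) * (b1 - tb1) - (1 - T1) * (b0 - tb0))))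
            + (1 - TT) * ((1 - T1) * (1 - T0)) * (-((S0 * sa1 - S1 * sa0) * (S0 * sb1 - S1 * sb0)))) := by
    rw [eTT, eSS, eAA, eBB, eTA, eTB, eSA, eSB, eTAB, eSAB]; ring
  have hlu : 0 ≤ (1 - TT) * SS := mul_nonneg hl hu
  have t1 : 0 ≤ P * ((1 - TT) * SS) * ((1 - T0) * S0) *
      ((1 - T1) * S1 * (tab1 - sab1) + S1 * (a1 - ta1) * (b1 - tb1) + (1 - T1) * sa1 * sb1 - (1 - T1) * S1 * a1 * b1) :=
    mul_nonneg (mul_nonneg (mul_nonneg hP0 hlu) (mul_nonneg hl0.le hS0.le)) h1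
  have t2 : 0 ≤ (1 - P) * ((1 - TT) * SS) * ((1 - T1) * S1) *
      ((1 - T0) * S0 * (tab0 - sab0) + S0 * (a0 - ta0) * (b0 - tb0) + (1 - T0) * sa0 * sb0 - (1 - T0) * S0 * a0 * b0) :=
    mul_nonneg (mul_nonneg (mul_nonneg hQ hlu) (mul_nonneg hl1.le hS1.le)) h0
  have t3 : 0 ≤ ((1 - TT) * SS) * ((1 - T1) * (1 - T0) * S1 * S0) * ((a1 - a0) * (b1 - b0)) :=
    mul_nonneg (mul_nonneg hlu (mul_nonneg (mul_nonneg (mul_nonneg hl1.le hl0.le) hS1.le) hS0.le))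
      (mul_nonneg (sub_nonneg.2 hA) (sub_nonneg.2 hB))
  have t4 : 0 ≤ SS * (S1 * S0) * (-(((1 - T0) * (a1 - ta1) - (1 - T1) * (a0 - ta0)) * ((1 - T0) * (b1 - tb1) - (1 - T1) * (b0 - tb0)))) :=
    mul_nonneg (mul_nonneg hu (mul_nonneg hS1.le hS0.le)) (neg_nonneg.2 (mul_nonpos_iff.2 (Or.inl ⟨hWA, hWB⟩)))
  have t5 : 0 ≤ (1 - TT) * ((1 - T1) * (1 - T0)) * (-((S0 * sa1 - S1 * sa0) * (S0 * sb1 - S1 * sb0))) :=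
    mul_nonneg (mul_nonneg hl (mul_nonneg hl1.le hl0.le))
      (neg_nonneg.2 (mul_nonpos_iff.2 (Or.inl ⟨sub_nonneg.2 hVA, sub_nonpos.2 hVB⟩)))
  have hrhs : 0 ≤ (1 - T1) * (1 - T0) * S1 * S0 *
      ((1 - TT) * SS * (TAB - SAB) + SS * (AA - TA) * (BB - TB) + (1 - TT) * SA * SB - (1 - TT) * SS * AA * BB) := by
    rw [key]
    exact add_nonneg (add_nonneg t1 t2) (mul_nonneg (mul_nonneg hP0 hQ) (add_nonneg (add_nonneg t3 t4) t5))
  have hpos : 0 < (1 - T1) * (1 - T0) * S1 * S0 := mul_pos (mul_pos (mul_pos hl1 hl0) hS1) hS0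
  exact (mul_nonneg_iff_of_pos_left hpos).1 hrhs

/-! ## The cross-form step lemma for `Ψ` -/

/-- **CROSS-FORM STEP LEMMA for the two-sided functional** (block `insert e F`, `e ∉ F`, levels `t+1 ≤ s+1` on `insert e F`): if `Ψ ≥ 0` for the
section pairs on `F` (levels `(t,s)` for the inner, `(t+1,s+1)` for the outer sections), the section slots are non-degenerate, the sections are monotone,
the LOWER drifts satisfy `W_A ≥ 0 ≥ W_B` and the UPPER drifts `V_A ≥ 0 ≥ V_B`, then `Ψ ≥ 0` on `insert e F`. [this work] -/
theorem twoLump_nonneg_of_cross (p : ι → unitInterval) {F : Finset ι} {e : ι} (heF : e ∉ F) (t s : ℕ) (A B : Set (Set ι))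
    (h1 : 0 ≤ (1 - (prodBernoulli p).real {ω : Set ι | t ≤ (F.filter (· ∈ ω)).card}) *
              (prodBernoulli p).real {ω : Set ι | s ≤ (F.filter (· ∈ ω)).card} *
              ((prodBernoulli p).real ({ω : Set ι | t ≤ (F.filter (· ∈ ω)).card} ∩ {ω : Set ι | insert e ω ∈ A} ∩ {ω : Set ι | insert e ω ∈ B})
                - (prodBernoulli p).real ({ω : Set ι | s ≤ (F.filter (· ∈ ω)).card} ∩ {ω : Set ι | insert e ω ∈ A} ∩ {ω : Set ι | insert e ω ∈ B}))
          + (prodBernoulli p).real {ω : Set ι | s ≤ (F.filter (· ∈ ω)).card} *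
              ((prodBernoulli p).real {ω : Set ι | insert e ω ∈ A} - (prodBernoulli p).real ({ω : Set ι | t ≤ (F.filter (· ∈ ω)).card} ∩ {ω : Set ι | insert e ω ∈ A})) *
              ((prodBernoulli p).real {ω : Set ι | insert e ω ∈ B} - (prodBernoulli p).real ({ω : Set ι | t ≤ (F.filter (· ∈ ω)).card} ∩ {ω : Set ι | insert e ω ∈ B}))
          + (1 - (prodBernoulli p).real {ω : Set ι | t ≤ (F.filter (· ∈ ω)).card}) *
              (prodBernoulli p).real ({ω : Set ι | s ≤ (F.filter (· ∈ ω)).card} ∩ {ω : Set ι | insert e ω ∈ A}) *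
              (prodBernoulli p).real ({ω : Set ι | s ≤ (F.filter (· ∈ ω)).card} ∩ {ω : Set ι | insert e ω ∈ B})
          - (1 - (prodBernoulli p).real {ω : Set ι | t ≤ (F.filter (· ∈ ω)).card}) *
              (prodBernoulli p).real {ω : Set ι | s ≤ (F.filter (· ∈ ω)).card} *
              (prodBernoulli p).real {ω : Set ι | insert e ω ∈ A} * (prodBernoulli p).real {ω : Set ι | insert e ω ∈ B})
    (h0 : 0 ≤ (1 - (prodBernoulli p).real {ω : Set ι | t + 1 ≤ (F.filter (· ∈ ω)).card}) *
              (prodBernoulli p).real {ω : Set ι | s + 1 ≤ (F.filter (· ∈ ω)).card} *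
              ((prodBernoulli p).real ({ω : Set ι | t + 1 ≤ (F.filter (· ∈ ω)).card} ∩ {ω : Set ι | ω \ {e} ∈ A} ∩ {ω : Set ι | ω \ {e} ∈ B})
                - (prodBernoulli p).real ({ω : Set ι | s + 1 ≤ (F.filter (· ∈ ω)).card} ∩ {ω : Set ι | ω \ {e} ∈ A} ∩ {ω : Set ι | ω \ {e} ∈ B}))
          + (prodBernoulli p).real {ω : Set ι | s + 1 ≤ (F.filter (· ∈ ω)).card} *
              ((prodBernoulli p).real {ω : Set ι | ω \ {e} ∈ A} - (prodBernoulli p).real ({ω : Set ι | t + 1 ≤ (F.filter (· ∈ ω)).card} ∩ {ω : Set ι | ω \ {e} ∈ A})) *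
              ((prodBernoulli p).real {ω : Set ι | ω \ {e} ∈ B} - (prodBernoulli p).real ({ω : Set ι | t + 1 ≤ (F.filter (· ∈ ω)).card} ∩ {ω : Set ι | ω \ {e} ∈ B}))
          + (1 - (prodBernoulli p).real {ω : Set ι | t + 1 ≤ (F.filter (· ∈ ω)).card}) *
              (prodBernoulli p).real ({ω : Set ι | s + 1 ≤ (F.filter (· ∈ ω)).card} ∩ {ω : Set ι | ω \ {e} ∈ A}) *
              (prodBernoulli p).real ({ω : Set ι | s + 1 ≤ (F.filter (· ∈ ω)).card} ∩ {ω : Set ι | ω \ {e} ∈ B})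
          - (1 - (prodBernoulli p).real {ω : Set ι | t + 1 ≤ (F.filter (· ∈ ω)).card}) *
              (prodBernoulli p).real {ω : Set ι | s + 1 ≤ (F.filter (· ∈ ω)).card} *
              (prodBernoulli p).real {ω : Set ι | ω \ {e} ∈ A} * (prodBernoulli p).real {ω : Set ι | ω \ {e} ∈ B})
    (hT1 : (prodBernoulli p).real {ω : Set ι | t ≤ (F.filter (· ∈ ω)).card} < 1)
    (hT0 : (prodBernoulli p).real {ω : Set ι | t + 1 ≤ (F.filter (· ∈ ω)).card} < 1)
    (hS1 : 0 < (prodBernoulli p).real {ω : Set ι | s ≤ (F.filter (· ∈ ω)).card})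
    (hS0 : 0 < (prodBernoulli p).real {ω : Set ι | s + 1 ≤ (F.filter (· ∈ ω)).card})
    (hA : (prodBernoulli p).real {ω : Set ι | ω \ {e} ∈ A} ≤ (prodBernoulli p).real {ω : Set ι | insert e ω ∈ A})
    (hB : (prodBernoulli p).real {ω : Set ι | ω \ {e} ∈ B} ≤ (prodBernoulli p).real {ω : Set ι | insert e ω ∈ B})
    (hWA : 0 ≤ (1 - (prodBernoulli p).real {ω : Set ι | t + 1 ≤ (F.filter (· ∈ ω)).card}) *
          ((prodBernoulli p).real {ω : Set ι | insert e ω ∈ A} - (prodBernoulli p).real ({ω : Set ι | t ≤ (F.filter (· ∈ ω)).card} ∩ {ω : Set ι | insert e ω ∈ A}))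
        - (1 - (prodBernoulli p).real {ω : Set ι | t ≤ (F.filter (· ∈ ω)).card}) *
          ((prodBernoulli p).real {ω : Set ι | ω \ {e} ∈ A} - (prodBernoulli p).real ({ω : Set ι | t + 1 ≤ (F.filter (· ∈ ω)).card} ∩ {ω : Set ι | ω \ {e} ∈ A})))
    (hWB : (1 - (prodBernoulli p).real {ω : Set ι | t + 1 ≤ (F.filter (· ∈ ω)).card}) *
          ((prodBernoulli p).real {ω : Set ι | insert e ω ∈ B} - (prodBernoulli p).real ({ω : Set ι | t ≤ (F.filter (· ∈ ω)).card} ∩ {ω : Set ι | insert e ω ∈ B}))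
        - (1 - (prodBernoulli p).real {ω : Set ι | t ≤ (F.filter (· ∈ ω)).card}) *
          ((prodBernoulli p).real {ω : Set ι | ω \ {e} ∈ B} - (prodBernoulli p).real ({ω : Set ι | t + 1 ≤ (F.filter (· ∈ ω)).card} ∩ {ω : Set ι | ω \ {e} ∈ B})) ≤ 0)
    (hVA : (prodBernoulli p).real {ω : Set ι | s ≤ (F.filter (· ∈ ω)).card} *
          (prodBernoulli p).real ({ω : Set ι | s + 1 ≤ (F.filter (· ∈ ω)).card} ∩ {ω : Set ι | ω \ {e} ∈ A}) ≤
        (prodBernoulli p).real {ω : Set ι | s + 1 ≤ (F.filter (· ∈ ω)).card} *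
          (prodBernoulli p).real ({ω : Set ι | s ≤ (F.filter (· ∈ ω)).card} ∩ {ω : Set ι | insert e ω ∈ A}))
    (hVB : (prodBernoulli p).real {ω : Set ι | s + 1 ≤ (F.filter (· ∈ ω)).card} *
          (prodBernoulli p).real ({ω : Set ι | s ≤ (F.filter (· ∈ ω)).card} ∩ {ω : Set ι | insert e ω ∈ B}) ≤
        (prodBernoulli p).real {ω : Set ι | s ≤ (F.filter (· ∈ ω)).card} *
          (prodBernoulli p).real ({ω : Set ι | s + 1 ≤ (F.filter (· ∈ ω)).card} ∩ {ω : Set ι | ω \ {e} ∈ B})) :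
    0 ≤ (1 - (prodBernoulli p).real {ω : Set ι | t + 1 ≤ ((insert e F).filter (· ∈ ω)).card}) *
            (prodBernoulli p).real {ω : Set ι | s + 1 ≤ ((insert e F).filter (· ∈ ω)).card} *
            ((prodBernoulli p).real ({ω : Set ι | t + 1 ≤ ((insert e F).filter (· ∈ ω)).card} ∩ A ∩ B)
              - (prodBernoulli p).real ({ω : Set ι | s + 1 ≤ ((insert e F).filter (· ∈ ω)).card} ∩ A ∩ B))
        + (prodBernoulli p).real {ω : Set ι | s + 1 ≤ ((insert e F).filter (· ∈ ω)).card} *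
            ((prodBernoulli p).real A - (prodBernoulli p).real ({ω : Set ι | t + 1 ≤ ((insert e F).filter (· ∈ ω)).card} ∩ A)) *
            ((prodBernoulli p).real B - (prodBernoulli p).real ({ω : Set ι | t + 1 ≤ ((insert e F).filter (· ∈ ω)).card} ∩ B))
        + (1 - (prodBernoulli p).real {ω : Set ι | t + 1 ≤ ((insert e F).filter (· ∈ ω)).card}) *
            (prodBernoulli p).real ({ω : Set ι | s + 1 ≤ ((insert e F).filter (· ∈ ω)).card} ∩ A) *
            (prodBernoulli p).real ({ω : Set ι | s + 1 ≤ ((insert e F).filter (· ∈ ω)).card} ∩ B)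
        - (1 - (prodBernoulli p).real {ω : Set ι | t + 1 ≤ ((insert e F).filter (· ∈ ω)).card}) *
            (prodBernoulli p).real {ω : Set ι | s + 1 ≤ ((insert e F).filter (· ∈ ω)).card} *
            (prodBernoulli p).real A * (prodBernoulli p).real B := by
  -- split the ten measures on `insert e F` along `e`
  have eTT : (prodBernoulli p).real {ω : Set ι | t + 1 ≤ ((insert e F).filter (· ∈ ω)).card} =
      (p e : ℝ) * (prodBernoulli p).real {ω : Set ι | t ≤ (F.filter (· ∈ ω)).card} +
        (1 - p e) * (prodBernoulli p).real {ω : Set ι | t + 1 ≤ (F.filter (· ∈ ω)).card} := by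
    rw [real_split p e, section_insert_threshold heF, section_sdiff_threshold heF]
  have eSS : (prodBernoulli p).real {ω : Set ι | s + 1 ≤ ((insert e F).filter (· ∈ ω)).card} =
      (p e : ℝ) * (prodBernoulli p).real {ω : Set ι | s ≤ (F.filter (· ∈ ω)).card} +
        (1 - p e) * (prodBernoulli p).real {ω : Set ι | s + 1 ≤ (F.filter (· ∈ ω)).card} := by
    rw [real_split p e, section_insert_threshold heF, section_sdiff_threshold heF]
  have eAA := real_split p e A
  have eBB := real_split p e B
  have eTA : (prodBernoulli p).real ({ω : Set ι | t + 1 ≤ ((insert e F).filter (· ∈ ω)).card} ∩ A) =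
      (p e : ℝ) * (prodBernoulli p).real ({ω : Set ι | t ≤ (F.filter (· ∈ ω)).card} ∩ {ω : Set ι | insert e ω ∈ A}) +
        (1 - p e) * (prodBernoulli p).real ({ω : Set ι | t + 1 ≤ (F.filter (· ∈ ω)).card} ∩ {ω : Set ι | ω \ {e} ∈ A}) := by
    rw [real_split p e, section_insert_inter, section_sdiff_inter, section_insert_threshold heF, section_sdiff_threshold heF]
  have eTB : (prodBernoulli p).real ({ω : Set ι | t + 1 ≤ ((insert e F).filter (· ∈ ω)).card} ∩ B) =
      (p e : ℝ) * (prodBernoulli p).real ({ω : Set ι | t ≤ (F.filter (· ∈ ω)).card} ∩ {ω : Set ι | insert e ω ∈ B}) +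
        (1 - p e) * (prodBernoulli p).real ({ω : Set ι | t + 1 ≤ (F.filter (· ∈ ω)).card} ∩ {ω : Set ι | ω \ {e} ∈ B}) := by
    rw [real_split p e, section_insert_inter, section_sdiff_inter, section_insert_threshold heF, section_sdiff_threshold heF]
  have eSA : (prodBernoulli p).real ({ω : Set ι | s + 1 ≤ ((insert e F).filter (· ∈ ω)).card} ∩ A) =
      (p e : ℝ) * (prodBernoulli p).real ({ω : Set ι | s ≤ (F.filter (· ∈ ω)).card} ∩ {ω : Set ι | insert e ω ∈ A}) +
        (1 - p e) * (prodBernoulli p).real ({ω : Set ι | s + 1 ≤ (F.filter (· ∈ ω)).card} ∩ {ω : Set ι | ω \ {e} ∈ A}) := by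
    rw [real_split p e, section_insert_inter, section_sdiff_inter, section_insert_threshold heF, section_sdiff_threshold heF]
  have eSB : (prodBernoulli p).real ({ω : Set ι | s + 1 ≤ ((insert e F).filter (· ∈ ω)).card} ∩ B) =
      (p e : ℝ) * (prodBernoulli p).real ({ω : Set ι | s ≤ (F.filter (· ∈ ω)).card} ∩ {ω : Set ι | insert e ω ∈ B}) +
        (1 - p e) * (prodBernoulli p).real ({ω : Set ι | s + 1 ≤ (F.filter (· ∈ ω)).card} ∩ {ω : Set ι | ω \ {e} ∈ B}) := by
    rw [real_split p e, section_insert_inter, section_sdiff_inter, section_insert_threshold heF, section_sdiff_threshold heF]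
  have eTAB : (prodBernoulli p).real ({ω : Set ι | t + 1 ≤ ((insert e F).filter (· ∈ ω)).card} ∩ A ∩ B) =
      (p e : ℝ) * (prodBernoulli p).real ({ω : Set ι | t ≤ (F.filter (· ∈ ω)).card} ∩ {ω : Set ι | insert e ω ∈ A} ∩ {ω : Set ι | insert e ω ∈ B}) +
        (1 - p e) * (prodBernoulli p).real ({ω : Set ι | t + 1 ≤ (F.filter (· ∈ ω)).card} ∩ {ω : Set ι | ω \ {e} ∈ A} ∩ {ω : Set ι | ω \ {e} ∈ B}) := by
    rw [real_split p e, section_insert_inter, section_sdiff_inter, section_insert_inter, section_sdiff_inter,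
      section_insert_threshold heF, section_sdiff_threshold heF]
  have eSAB : (prodBernoulli p).real ({ω : Set ι | s + 1 ≤ ((insert e F).filter (· ∈ ω)).card} ∩ A ∩ B) =
      (p e : ℝ) * (prodBernoulli p).real ({ω : Set ι | s ≤ (F.filter (· ∈ ω)).card} ∩ {ω : Set ι | insert e ω ∈ A} ∩ {ω : Set ι | insert e ω ∈ B}) +
        (1 - p e) * (prodBernoulli p).real ({ω : Set ι | s + 1 ≤ (F.filter (· ∈ ω)).card} ∩ {ω : Set ι | ω \ {e} ∈ A} ∩ {ω : Set ι | ω \ {e} ∈ B}) := by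
    rw [real_split p e, section_insert_inter, section_sdiff_inter, section_insert_inter, section_sdiff_inter,
      section_insert_threshold heF, section_sdiff_threshold heF]
  have hVA' : (prodBernoulli p).real {ω : Set ι | s ≤ (F.filter (· ∈ ω)).card} *
        (prodBernoulli p).real ({ω : Set ι | s + 1 ≤ (F.filter (· ∈ ω)).card} ∩ {ω : Set ι | ω \ {e} ∈ A}) ≤
      (prodBernoulli p).real {ω : Set ι | s + 1 ≤ (F.filter (· ∈ ω)).card} *
        (prodBernoulli p).real ({ω : Set ι | s ≤ (F.filter (· ∈ ω)).card} ∩ {ω : Set ι | insert e ω ∈ A}) := hVA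
  exact twoLump_step_real (p e : ℝ) _ _ _ _ _ _ _ _ _ _ _ _ _ _ _ _ _ _ _ _ _ _ _ _ _ _ _ _ _ _
    (p e).2.1 (p e).2.2 hT1 hT0 hS1 hS0 eTT eSS eAA eBB eTA eTB eSA eSB eTAB eSAB h1 h0 hA hB hWA hWB hVA' hVB


/-! ## `Ψ` does not increase under the lower hull (`T_t`-generation) of `B` -/

/-- **`T_t`-generation of `B` does not increase `Ψ`** (memo TL2(b)): with the traces on `T_t ⊇ T_s` fixed, `Ψ` is affine in `μ(B)` with slope
`μT_s·(μT_t·μA − μ(T_t ∩ A)) ≤ 0` (Harris), and `μ(B) ≤ μ(B^*)`. [this work] -/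
theorem twoLump_hgen_le (p : ι → unitInterval) (G : Finset ι) {t s : ℕ} (hts : t ≤ s) {A B : Set (Set ι)}
    (hA : IsUpperSet A) (hB : IsUpperSet B) :
    (1 - (prodBernoulli p).real {ω : Set ι | t ≤ (G.filter (· ∈ ω)).card}) *
            (prodBernoulli p).real {ω : Set ι | s ≤ (G.filter (· ∈ ω)).card} *
            ((prodBernoulli p).real ({ω : Set ι | t ≤ (G.filter (· ∈ ω)).card} ∩ A ∩ {ω : Set ι | ∀ ω' : Set ι, ω ⊆ ω' → ω' ∈ {ω : Set ι | t ≤ (G.filter (· ∈ ω)).card} → ω' ∈ B})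
              - (prodBernoulli p).real ({ω : Set ι | s ≤ (G.filter (· ∈ ω)).card} ∩ A ∩ {ω : Set ι | ∀ ω' : Set ι, ω ⊆ ω' → ω' ∈ {ω : Set ι | t ≤ (G.filter (· ∈ ω)).card} → ω' ∈ B}))
        + (prodBernoulli p).real {ω : Set ι | s ≤ (G.filter (· ∈ ω)).card} *
            ((prodBernoulli p).real A - (prodBernoulli p).real ({ω : Set ι | t ≤ (G.filter (· ∈ ω)).card} ∩ A)) *
            ((prodBernoulli p).real {ω : Set ι | ∀ ω' : Set ι, ω ⊆ ω' → ω' ∈ {ω : Set ι | t ≤ (G.filter (· ∈ ω)).card} → ω' ∈ B} - (prodBernoulli p).real ({ω : Set ι | t ≤ (G.filter (· ∈ ω)).card} ∩ {ω : Set ι | ∀ ω' : Set ι, ω ⊆ ω' → ω' ∈ {ω : Set ι | t ≤ (G.filter (· ∈ ω)).card} → ω' ∈ B}))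
        + (1 - (prodBernoulli p).real {ω : Set ι | t ≤ (G.filter (· ∈ ω)).card}) *
            (prodBernoulli p).real ({ω : Set ι | s ≤ (G.filter (· ∈ ω)).card} ∩ A) *
            (prodBernoulli p).real ({ω : Set ι | s ≤ (G.filter (· ∈ ω)).card} ∩ {ω : Set ι | ∀ ω' : Set ι, ω ⊆ ω' → ω' ∈ {ω : Set ι | t ≤ (G.filter (· ∈ ω)).card} → ω' ∈ B})
        - (1 - (prodBernoulli p).real {ω : Set ι | t ≤ (G.filter (· ∈ ω)).card}) *
            (prodBernoulli p).real {ω : Set ι | s ≤ (G.filter (· ∈ ω)).card} *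
            (prodBernoulli p).real A * (prodBernoulli p).real {ω : Set ι | ∀ ω' : Set ι, ω ⊆ ω' → ω' ∈ {ω : Set ι | t ≤ (G.filter (· ∈ ω)).card} → ω' ∈ B}
    ≤ (1 - (prodBernoulli p).real {ω : Set ι | t ≤ (G.filter (· ∈ ω)).card}) *
            (prodBernoulli p).real {ω : Set ι | s ≤ (G.filter (· ∈ ω)).card} *
            ((prodBernoulli p).real ({ω : Set ι | t ≤ (G.filter (· ∈ ω)).card} ∩ A ∩ B)
              - (prodBernoulli p).real ({ω : Set ι | s ≤ (G.filter (· ∈ ω)).card} ∩ A ∩ B))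
        + (prodBernoulli p).real {ω : Set ι | s ≤ (G.filter (· ∈ ω)).card} *
            ((prodBernoulli p).real A - (prodBernoulli p).real ({ω : Set ι | t ≤ (G.filter (· ∈ ω)).card} ∩ A)) *
            ((prodBernoulli p).real B - (prodBernoulli p).real ({ω : Set ι | t ≤ (G.filter (· ∈ ω)).card} ∩ B))
        + (1 - (prodBernoulli p).real {ω : Set ι | t ≤ (G.filter (· ∈ ω)).card}) *
            (prodBernoulli p).real ({ω : Set ι | s ≤ (G.filter (· ∈ ω)).card} ∩ A) *
            (prodBernoulli p).real ({ω : Set ι | s ≤ (G.filter (· ∈ ω)).card} ∩ B)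
        - (1 - (prodBernoulli p).real {ω : Set ι | t ≤ (G.filter (· ∈ ω)).card}) *
            (prodBernoulli p).real {ω : Set ι | s ≤ (G.filter (· ∈ ω)).card} *
            (prodBernoulli p).real A * (prodBernoulli p).real B := by
  have hTt : IsUpperSet {ω : Set ι | t ≤ (G.filter (· ∈ ω)).card} := isUpperSet_threshold G t
  have hsub : {ω : Set ι | s ≤ (G.filter (· ∈ ω)).card} ⊆ {ω : Set ι | t ≤ (G.filter (· ∈ ω)).card} := fun _ h => le_trans hts h
  -- traces of the hull
  have e1 : {ω : Set ι | t ≤ (G.filter (· ∈ ω)).card} ∩ {ω : Set ι | ∀ ω' : Set ι, ω ⊆ ω' → ω' ∈ {ω : Set ι | t ≤ (G.filter (· ∈ ω)).card} → ω' ∈ B} = {ω : Set ι | t ≤ (G.filter (· ∈ ω)).card} ∩ B := inter_hgen_eq _ hB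
  have e2 : {ω : Set ι | s ≤ (G.filter (· ∈ ω)).card} ∩ {ω : Set ι | ∀ ω' : Set ι, ω ⊆ ω' → ω' ∈ {ω : Set ι | t ≤ (G.filter (· ∈ ω)).card} → ω' ∈ B} = {ω : Set ι | s ≤ (G.filter (· ∈ ω)).card} ∩ B := by
    have h := congrArg ({ω : Set ι | s ≤ (G.filter (· ∈ ω)).card} ∩ ·) e1
    simp only [← Set.inter_assoc, Set.inter_eq_left.2 hsub] at h
    exact h
  have e3 : {ω : Set ι | t ≤ (G.filter (· ∈ ω)).card} ∩ A ∩ {ω : Set ι | ∀ ω' : Set ι, ω ⊆ ω' → ω' ∈ {ω : Set ι | t ≤ (G.filter (· ∈ ω)).card} → ω' ∈ B} = {ω : Set ι | t ≤ (G.filter (· ∈ ω)).card} ∩ A ∩ B := by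
    rw [Set.inter_assoc, Set.inter_comm A, ← Set.inter_assoc, e1, Set.inter_assoc, Set.inter_comm B, ← Set.inter_assoc]
  have e4 : {ω : Set ι | s ≤ (G.filter (· ∈ ω)).card} ∩ A ∩ {ω : Set ι | ∀ ω' : Set ι, ω ⊆ ω' → ω' ∈ {ω : Set ι | t ≤ (G.filter (· ∈ ω)).card} → ω' ∈ B} = {ω : Set ι | s ≤ (G.filter (· ∈ ω)).card} ∩ A ∩ B := by
    rw [Set.inter_assoc, Set.inter_comm A, ← Set.inter_assoc, e2, Set.inter_assoc, Set.inter_comm B, ← Set.inter_assoc]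
  rw [e1, e2, e3, e4]
  have hmono : (prodBernoulli p).real B ≤ (prodBernoulli p).real {ω : Set ι | ∀ ω' : Set ι, ω ⊆ ω' → ω' ∈ {ω : Set ι | t ≤ (G.filter (· ∈ ω)).card} → ω' ∈ B} := measureReal_mono (subset_hgen _ hB)
  have hHarris : (prodBernoulli p).real {ω : Set ι | t ≤ (G.filter (· ∈ ω)).card} * (prodBernoulli p).real A ≤ (prodBernoulli p).real ({ω : Set ι | t ≤ (G.filter (· ∈ ω)).card} ∩ A) :=
    prodBernoulli_harris p hTt hA MeasurableSet.of_discrete MeasurableSet.of_discrete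
  have hTs0 : 0 ≤ (prodBernoulli p).real {ω : Set ι | s ≤ (G.filter (· ∈ ω)).card} := measureReal_nonneg
  have h3 : 0 ≤ (prodBernoulli p).real {ω : Set ι | s ≤ (G.filter (· ∈ ω)).card} * ((prodBernoulli p).real {ω : Set ι | ∀ ω' : Set ι, ω ⊆ ω' → ω' ∈ {ω : Set ι | t ≤ (G.filter (· ∈ ω)).card} → ω' ∈ B} - (prodBernoulli p).real B) *
      ((prodBernoulli p).real ({ω : Set ι | t ≤ (G.filter (· ∈ ω)).card} ∩ A) - (prodBernoulli p).real {ω : Set ι | t ≤ (G.filter (· ∈ ω)).card} * (prodBernoulli p).real A) :=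
    mul_nonneg (mul_nonneg hTs0 (sub_nonneg.2 hmono)) (sub_nonneg.2 hHarris)
  nlinarith [h3]


/-! ## `Ψ` does not increase under opposite compressions -/

/-- The middle region `T_t ∖ T_s` splits `T_t ∩ X ∩ Y`. [folklore] -/
theorem real_threshold_inter_inter_eq_add (p : ι → unitInterval) (G : Finset ι) {t s : ℕ} (hts : t ≤ s) (X Y : Set (Set ι)) :
    (prodBernoulli p).real ({ω : Set ι | t ≤ (G.filter (· ∈ ω)).card} ∩ X ∩ Y) =
      (prodBernoulli p).real ({ω : Set ι | s ≤ (G.filter (· ∈ ω)).card} ∩ X ∩ Y) +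
        (prodBernoulli p).real (X ∩ Y ∩ {ω : Set ι | t ≤ (G.filter (· ∈ ω)).card ∧ (G.filter (· ∈ ω)).card < s}) := by
  have hset : {ω : Set ι | t ≤ (G.filter (· ∈ ω)).card} ∩ X ∩ Y =
      ({ω : Set ι | s ≤ (G.filter (· ∈ ω)).card} ∩ X ∩ Y) ∪ (X ∩ Y ∩ {ω : Set ι | t ≤ (G.filter (· ∈ ω)).card ∧ (G.filter (· ∈ ω)).card < s}) := by
    ext ω
    simp only [Set.mem_inter_iff, Set.mem_setOf_eq, Set.mem_union]
    constructor
    · rintro ⟨⟨ht, hx⟩, hy⟩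
      by_cases hs : s ≤ (G.filter (· ∈ ω)).card
      · exact Or.inl ⟨⟨hs, hx⟩, hy⟩
      · exact Or.inr ⟨⟨hx, hy⟩, ht, by omega⟩
    · rintro (⟨⟨hs, hx⟩, hy⟩ | ⟨⟨hx, hy⟩, ht, _⟩)
      · exact ⟨⟨le_trans hts hs, hx⟩, hy⟩
      · exact ⟨⟨ht, hx⟩, hy⟩
  have hdisj : Disjoint ({ω : Set ι | s ≤ (G.filter (· ∈ ω)).card} ∩ X ∩ Y) (X ∩ Y ∩ {ω : Set ι | t ≤ (G.filter (· ∈ ω)).card ∧ (G.filter (· ∈ ω)).card < s}) :=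
    Set.disjoint_left.2 fun ω h1 h2 => by
      simp only [Set.mem_inter_iff, Set.mem_setOf_eq] at h1 h2
      omega
  rw [hset]
  exact measureReal_union hdisj MeasurableSet.of_discrete

omit [Fintype ι] in
/-- The middle region is `G`-determined. [folklore] -/
theorem determinedBy_middle (G : Finset ι) (t s : ℕ) :
    DeterminedBy {ω : Set ι | t ≤ (G.filter (· ∈ ω)).card ∧ (G.filter (· ∈ ω)).card < s} (↑G : Set ι) := by
  have h1 := (determinedBy_iff _ _).1 (determinedBy_threshold G t)
  have h2 := (determinedBy_iff _ _).1 (determinedBy_threshold G s)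
  rw [determinedBy_iff]
  intro ω ω' h
  have a := h1 ω ω' h
  have b := h2 ω ω' h
  simp only [Set.mem_setOf_eq] at a b ⊢
  rw [not_le.symm.trans (not_congr b) |>.trans not_le] at *
  exact and_congr a Iff.rfl

omit [Fintype ι] in
/-- The middle region is swap-invariant (`e, j ∈ G`). [folklore] -/
theorem swapSet_mem_middle_iff {e j : ι} {G : Finset ι} (he : e ∈ G) (hj : j ∈ G) (t s : ℕ) (ω : Set ι) :
    {x : ι | Equiv.swap e j x ∈ ω} ∈ {ω : Set ι | t ≤ (G.filter (· ∈ ω)).card ∧ (G.filter (· ∈ ω)).card < s} ↔ ω ∈ {ω : Set ι | t ≤ (G.filter (· ∈ ω)).card ∧ (G.filter (· ∈ ω)).card < s} := by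
  simp only [Set.mem_setOf_eq, card_filter_swapSet he hj ω]

/-- **Opposite compression does not increase `Ψ`** (memo TL2(a)): for a block `G ∋ e, j` with `p e = p j`, the compression `C` of `A` towards `e`
and `C'` of `B` towards `j` satisfy `Ψ(C, C') ≤ Ψ(A, B)` — all layer counts are preserved and the common mass in the middle region drops. [this work] -/
theorem twoLump_compress_le (p : ι → unitInterval) {e j : ι} {G : Finset ι} (he : e ∈ G) (hj : j ∈ G) (hp : p e = p j) {t s : ℕ} (hts : t ≤ s)
    {A B C C' : Set (Set ι)} (hAG : DeterminedBy A (↑G : Set ι)) (hBG : DeterminedBy B (↑G : Set ι))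
    (hC : ∀ ω : Set ι, ω ∈ C ↔ (ω ∈ A ∧ {x : ι | Equiv.swap e j x ∈ ω} ∈ A) ∨ (e ∈ ω ∧ j ∉ ω ∧ (ω ∈ A ∨ {x : ι | Equiv.swap e j x ∈ ω} ∈ A)))
    (hC' : ∀ ω : Set ι, ω ∈ C' ↔ (ω ∈ B ∧ {x : ι | Equiv.swap e j x ∈ ω} ∈ B) ∨ (j ∈ ω ∧ e ∉ ω ∧ (ω ∈ B ∨ {x : ι | Equiv.swap e j x ∈ ω} ∈ B))) :
    (1 - (prodBernoulli p).real {ω : Set ι | t ≤ (G.filter (· ∈ ω)).card}) *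
            (prodBernoulli p).real {ω : Set ι | s ≤ (G.filter (· ∈ ω)).card} *
            ((prodBernoulli p).real ({ω : Set ι | t ≤ (G.filter (· ∈ ω)).card} ∩ C ∩ C')
              - (prodBernoulli p).real ({ω : Set ι | s ≤ (G.filter (· ∈ ω)).card} ∩ C ∩ C'))
        + (prodBernoulli p).real {ω : Set ι | s ≤ (G.filter (· ∈ ω)).card} *
            ((prodBernoulli p).real C - (prodBernoulli p).real ({ω : Set ι | t ≤ (G.filter (· ∈ ω)).card} ∩ C)) *
            ((prodBernoulli p).real C' - (prodBernoulli p).real ({ω : Set ι | t ≤ (G.filter (· ∈ ω)).card} ∩ C'))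
        + (1 - (prodBernoulli p).real {ω : Set ι | t ≤ (G.filter (· ∈ ω)).card}) *
            (prodBernoulli p).real ({ω : Set ι | s ≤ (G.filter (· ∈ ω)).card} ∩ C) *
            (prodBernoulli p).real ({ω : Set ι | s ≤ (G.filter (· ∈ ω)).card} ∩ C')
        - (1 - (prodBernoulli p).real {ω : Set ι | t ≤ (G.filter (· ∈ ω)).card}) *
            (prodBernoulli p).real {ω : Set ι | s ≤ (G.filter (· ∈ ω)).card} *
            (prodBernoulli p).real C * (prodBernoulli p).real C'
    ≤ (1 - (prodBernoulli p).real {ω : Set ι | t ≤ (G.filter (· ∈ ω)).card}) *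
            (prodBernoulli p).real {ω : Set ι | s ≤ (G.filter (· ∈ ω)).card} *
            ((prodBernoulli p).real ({ω : Set ι | t ≤ (G.filter (· ∈ ω)).card} ∩ A ∩ B)
              - (prodBernoulli p).real ({ω : Set ι | s ≤ (G.filter (· ∈ ω)).card} ∩ A ∩ B))
        + (prodBernoulli p).real {ω : Set ι | s ≤ (G.filter (· ∈ ω)).card} *
            ((prodBernoulli p).real A - (prodBernoulli p).real ({ω : Set ι | t ≤ (G.filter (· ∈ ω)).card} ∩ A)) *
            ((prodBernoulli p).real B - (prodBernoulli p).real ({ω : Set ι | t ≤ (G.filter (· ∈ ω)).card} ∩ B))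
        + (1 - (prodBernoulli p).real {ω : Set ι | t ≤ (G.filter (· ∈ ω)).card}) *
            (prodBernoulli p).real ({ω : Set ι | s ≤ (G.filter (· ∈ ω)).card} ∩ A) *
            (prodBernoulli p).real ({ω : Set ι | s ≤ (G.filter (· ∈ ω)).card} ∩ B)
        - (1 - (prodBernoulli p).real {ω : Set ι | t ≤ (G.filter (· ∈ ω)).card}) *
            (prodBernoulli p).real {ω : Set ι | s ≤ (G.filter (· ∈ ω)).card} *
            (prodBernoulli p).real A * (prodBernoulli p).real B := by
  have hTtG : DeterminedBy {ω : Set ι | t ≤ (G.filter (· ∈ ω)).card} (↑G : Set ι) := determinedBy_threshold G t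
  have hTsG : DeterminedBy {ω : Set ι | s ≤ (G.filter (· ∈ ω)).card} (↑G : Set ι) := determinedBy_threshold G s
  have hTtτ : ∀ ω : Set ι, {x : ι | Equiv.swap e j x ∈ ω} ∈ {ω : Set ι | t ≤ (G.filter (· ∈ ω)).card} ↔ ω ∈ {ω : Set ι | t ≤ (G.filter (· ∈ ω)).card} := swapSet_mem_threshold_iff he hj t
  have hTsτ : ∀ ω : Set ι, {x : ι | Equiv.swap e j x ∈ ω} ∈ {ω : Set ι | s ≤ (G.filter (· ∈ ω)).card} ↔ ω ∈ {ω : Set ι | s ≤ (G.filter (· ∈ ω)).card} := swapSet_mem_threshold_iff he hj s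
  have huniv : DeterminedBy (Set.univ : Set (Set ι)) (↑G : Set ι) := (determinedBy_iff _ _).2 fun _ _ _ => by simp
  have hC'' : ∀ ω : Set ι, ω ∈ C' ↔ (ω ∈ B ∧ {x : ι | Equiv.swap j e x ∈ ω} ∈ B) ∨
      (j ∈ ω ∧ e ∉ ω ∧ (ω ∈ B ∨ {x : ι | Equiv.swap j e x ∈ ω} ∈ B)) := by
    intro ω; rw [Equiv.swap_comm j e]; exact hC' ω
  have hTtτ' : ∀ ω : Set ι, {x : ι | Equiv.swap j e x ∈ ω} ∈ {ω : Set ι | t ≤ (G.filter (· ∈ ω)).card} ↔ ω ∈ {ω : Set ι | t ≤ (G.filter (· ∈ ω)).card} := by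
    intro ω; rw [Equiv.swap_comm j e]; exact hTtτ ω
  have hTsτ' : ∀ ω : Set ι, {x : ι | Equiv.swap j e x ∈ ω} ∈ {ω : Set ι | s ≤ (G.filter (· ∈ ω)).card} ↔ ω ∈ {ω : Set ι | s ≤ (G.filter (· ∈ ω)).card} := by
    intro ω; rw [Equiv.swap_comm j e]; exact hTsτ ω
  -- the preserved measures
  have e1 : (prodBernoulli p).real ({ω : Set ι | t ≤ (G.filter (· ∈ ω)).card} ∩ C) = (prodBernoulli p).real ({ω : Set ι | t ≤ (G.filter (· ∈ ω)).card} ∩ A) := by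
    rw [Set.inter_comm _ C, Set.inter_comm _ A]; exact real_compress_inter_eq p he hj hp hAG hTtG hTtτ hC
  have e1s : (prodBernoulli p).real ({ω : Set ι | s ≤ (G.filter (· ∈ ω)).card} ∩ C) = (prodBernoulli p).real ({ω : Set ι | s ≤ (G.filter (· ∈ ω)).card} ∩ A) := by
    rw [Set.inter_comm _ C, Set.inter_comm _ A]; exact real_compress_inter_eq p he hj hp hAG hTsG hTsτ hC
  have e2 : (prodBernoulli p).real ({ω : Set ι | t ≤ (G.filter (· ∈ ω)).card} ∩ C') = (prodBernoulli p).real ({ω : Set ι | t ≤ (G.filter (· ∈ ω)).card} ∩ B) := by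
    rw [Set.inter_comm _ C', Set.inter_comm _ B]; exact real_compress_inter_eq p hj he hp.symm hBG hTtG hTtτ' hC''
  have e2s : (prodBernoulli p).real ({ω : Set ι | s ≤ (G.filter (· ∈ ω)).card} ∩ C') = (prodBernoulli p).real ({ω : Set ι | s ≤ (G.filter (· ∈ ω)).card} ∩ B) := by
    rw [Set.inter_comm _ C', Set.inter_comm _ B]; exact real_compress_inter_eq p hj he hp.symm hBG hTsG hTsτ' hC''
  have e3 : (prodBernoulli p).real C = (prodBernoulli p).real A := by
    have h := real_compress_inter_eq p he hj hp hAG huniv (fun _ => by simp) hC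
    simp only [Set.inter_univ] at h; exact h
  have e4 : (prodBernoulli p).real C' = (prodBernoulli p).real B := by
    have h := real_compress_inter_eq p hj he hp.symm hBG huniv (fun _ => by simp) hC''
    simp only [Set.inter_univ] at h; exact h
  -- the middle region loses common mass
  have e5 : (prodBernoulli p).real (C ∩ C' ∩ {ω : Set ι | t ≤ (G.filter (· ∈ ω)).card ∧ (G.filter (· ∈ ω)).card < s}) ≤
      (prodBernoulli p).real (A ∩ B ∩ {ω : Set ι | t ≤ (G.filter (· ∈ ω)).card ∧ (G.filter (· ∈ ω)).card < s}) :=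
    real_compress_inter_compress_inter_le p he hj hp hAG hBG (determinedBy_middle G t s) (swapSet_mem_middle_iff he hj t s) hC hC'
  -- `T_s ∩ C ∩ C'` versus `T_s ∩ A ∩ B`: both are swap-invariant traces; use the split and preserved masses
  rw [real_threshold_inter_inter_eq_add p G hts C C', real_threshold_inter_inter_eq_add p G hts A B, e1, e1s, e2, e2s, e3, e4]
  have hcoef : 0 ≤ (1 - (prodBernoulli p).real {ω : Set ι | t ≤ (G.filter (· ∈ ω)).card}) * (prodBernoulli p).real {ω : Set ι | s ≤ (G.filter (· ∈ ω)).card} :=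
    mul_nonneg (sub_nonneg.2 measureReal_le_one) measureReal_nonneg
  nlinarith [mul_le_mul_of_nonneg_left e5 hcoef]

end SahiOneStep

end Summit.CriticalPhenomena.PercolationContinuityZ3.Theorems
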